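import Summits.ValiantsHypothesis.ValiantsHypothesis.Theorems.DivisionGapZeroOneTransferStubFormulaGridProjectionAux2

/-!
# Crux `DivisionGap.ZeroOneTransfer` (stmt-ValiantsHypothesis-5066), line `planar-dimer-sign-elimination` —
stub `stub_formulaGridProjection`, support file 4: gadgets IN THE SQUARE GRID — cells, labels,
fillers, and the row gadget

From here on the vertex type is the grid `ℕ × ℕ` with its four-neighbour adjacency `Adj⟦a, b⟧`
(verbatim the four disjuncts of the route's grid-dimer polynomial) and rectangles of cells
`box⟦r, c, h, w⟧`.  A GRID GADGET `Gad⟦W, r, c, h, w, g⟧` is a dart-weight function `W` all of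
whose values are LABELS (`IsLab⟦·⟧`: literally a variable `X j` or a constant `C c`, the entries
of a Valiant projection), whose non-zero darts join adjacent cells of the rectangle, and which makes
the rectangle a two-state gadget (file 2) for `g` with ports its top-left and top-right cells.

* `gad_fill`, `gad_fill'` — extend a gadget to a bigger vertex set by a forced domino tiling of
  unit weight (`twoState_filler`), in the two hypothesis formats used later;
* `gad_row` — the ROW GADGET on an `h × (2k+2)` rectangle: the top row is a path whose first edge
  carries the label `ℓ`, everything else unit, the rows below tiled by horizontal dominoes; it is
  a grid gadget for `ℓ` (leaves `h = 2, k = 0`; unit pads `ℓ = 1`).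

Registered sub-goal proved here: `stub_formulaGridProjection_rowGadget` (the row gadget with the
notation expanded). [folklore]
-/

set_option linter.dupNamespace false

namespace Summit.ValiantsHypothesis.ValiantsHypothesis.Theorems.DivisionGapZeroOneTransfer

namespace FormulaGridProjection

open Finset MvPolynomial

/-- `TwoState⟦D, W, p, q, g⟧` (a LOCAL NOTATION, deliberately not a definition): a TWO-STATE GADGET on the
vertex set `D` with ports `p ≠ q` computing `g` — the whole of `D` has matching sum `g` ("active": both
ports matched inside), `D ∖ {p, q}` has matching sum `1` ("inactive"), and `|D|` is even (so the two
mixed states have matching sum `0` by parity).  The two-attachment case of a gadget signature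
(Valiant 1979 §2; DKLM 2010 §4.4). -/
local notation3 "TwoState⟦" D ", " W ", " p ", " q ", " g "⟧" =>
  p ∈ D ∧ q ∈ D ∧ p ≠ q ∧ Even (Finset.card D) ∧ msum D W = g ∧
    msum (Finset.erase (Finset.erase D p) q) W = 1


/-- `IsLab⟦x⟧` (local notation): `x` is literally a variable `X j` or a constant `C c` — the entries
allowed in a Valiant projection (`IsProjection`). -/
local notation3 "IsLab⟦" x "⟧" => (∃ j, x = MvPolynomial.X j) ∨ ∃ c, x = MvPolynomial.C c

/-- `Adj⟦a, b⟧` (local notation): adjacency of the square grid on `ℕ × ℕ`, verbatim the four disjuncts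
of the route's grid-dimer polynomial. -/
local notation3 "Adj⟦" a ", " b "⟧" =>
  (Prod.fst a + 1 = Prod.fst b ∧ Prod.snd a = Prod.snd b) ∨
    (Prod.fst b + 1 = Prod.fst a ∧ Prod.snd a = Prod.snd b) ∨
    (Prod.fst a = Prod.fst b ∧ Prod.snd a + 1 = Prod.snd b) ∨
    (Prod.fst a = Prod.fst b ∧ Prod.snd b + 1 = Prod.snd a)

/-- `box⟦r, c, h, w⟧` (local notation): the `h × w` rectangle of cells with top-left cell `(r, c)`
(rows `r ≤ i < r + h`, columns `c ≤ j < c + w`). -/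
local notation3 "box⟦" r ", " c ", " h ", " w "⟧" =>
  (Finset.Ico r (r + h) ×ˢ Finset.Ico c (c + w) : Finset (ℕ × ℕ))

/-- `Gad⟦W, r, c, h, w, g⟧` (local notation): `W` is a GRID GADGET for `g` on the rectangle
`box⟦r, c, h, w⟧` — every dart weight is a label, non-zero weights only on darts between adjacent
cells of the rectangle, and the rectangle is a two-state gadget computing `g` with ports its
top-left and top-right cells. -/
local notation3 "Gad⟦" W ", " r ", " c ", " h ", " w ", " g "⟧" =>
  (∀ a b, IsLab⟦W a b⟧) ∧ (∀ a b, W a b ≠ 0 → a ∈ box⟦r, c, h, w⟧ ∧ b ∈ box⟦r, c, h, w⟧ ∧ Adj⟦a, b⟧) ∧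
    TwoState⟦box⟦r, c, h, w⟧, W, (r, c), (r, c + w - 1), g⟧

section Grid

variable {R : Type*} [CommSemiring R] {ι : Type*}

/-- Membership in a rectangle of cells. [folklore] -/
theorem mem_box {r c h w : ℕ} {v : ℕ × ℕ} :
    v ∈ box⟦r, c, h, w⟧ ↔ r ≤ v.1 ∧ v.1 < r + h ∧ c ≤ v.2 ∧ v.2 < c + w := by
  simp only [Finset.mem_product, Finset.mem_Ico, and_assoc]

/-- A rectangle of cells has `h * w` cells. [folklore] -/
theorem card_box (r c h w : ℕ) : (box⟦r, c, h, w⟧).card = h * w := by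
  rw [Finset.card_product, Nat.card_Ico, Nat.card_Ico, Nat.add_sub_cancel_left,
    Nat.add_sub_cancel_left]

/-- `0 = C 0` is a label. [folklore] -/
theorem isLab_zero : IsLab⟦(0 : MvPolynomial ι R)⟧ := Or.inr ⟨0, C_0.symm⟩

/-- `1 = C 1` is a label. [folklore] -/
theorem isLab_one : IsLab⟦(1 : MvPolynomial ι R)⟧ := Or.inr ⟨1, C_1.symm⟩

/-- A case distinction between labels is a label. [folklore] -/
theorem isLab_ite {P : Prop} [Decidable P] {x y : MvPolynomial ι R} (hx : IsLab⟦x⟧)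
    (hy : IsLab⟦y⟧) : IsLab⟦if P then x else y⟧ := by
  split_ifs <;> assumption

/-- A sum of two labels one of which vanishes is a label. [folklore] -/
theorem isLab_add {x y : MvPolynomial ι R} (hx : IsLab⟦x⟧) (hy : IsLab⟦y⟧) (h : x = 0 ∨ y = 0) :
    IsLab⟦x + y⟧ := by
  rcases h with rfl | rfl
  · rwa [zero_add]
  · rwa [add_zero]

/-- **Fillers in the grid.** A two-state gadget `W` on `D ⊆ B` all of whose non-zero darts join
adjacent cells of `D` extends to `B` once `B ∖ D` carries a domino tiling `τ`: put weight `1` on the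
darts `a → τ a` of the tiling and keep everything else (`twoState_filler`). [folklore] -/
theorem gad_fill {W : ℕ × ℕ → ℕ × ℕ → MvPolynomial ι R} {D B : Finset (ℕ × ℕ)} {p q : ℕ × ℕ}
    {g : MvPolynomial ι R} (τ : ℕ × ℕ → ℕ × ℕ) (hlab : ∀ a b, IsLab⟦W a b⟧)
    (hsupp : ∀ a b, W a b ≠ 0 → a ∈ D ∧ b ∈ D ∧ Adj⟦a, b⟧) (hT : TwoState⟦D, W, p, q, g⟧)
    (hDB : D ⊆ B) (hτ : ∀ a ∈ B \ D, τ a ∈ B \ D ∧ τ a ≠ a ∧ τ (τ a) = a ∧ Adj⟦a, τ a⟧) :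
    ∃ W' : ℕ × ℕ → ℕ × ℕ → MvPolynomial ι R, (∀ a b, IsLab⟦W' a b⟧) ∧
      (∀ a b, W' a b ≠ 0 → a ∈ B ∧ b ∈ B ∧ Adj⟦a, b⟧) ∧ TwoState⟦B, W', p, q, g⟧ := by
  refine ⟨fun a b => if a ∈ B \ D ∧ b = τ a then 1 else W a b, fun a b => isLab_ite isLab_one (hlab a b),
    ?_, ?_⟩
  · intro a b hab
    by_cases h : a ∈ B \ D ∧ b = τ a
    · obtain ⟨ha, rfl⟩ := h
      exact ⟨(Finset.mem_sdiff.1 ha).1, (Finset.mem_sdiff.1 (hτ a ha).1).1, (hτ a ha).2.2.2⟩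
    · dsimp only at hab
      rw [if_neg h] at hab
      obtain ⟨ha, hb, hadj⟩ := hsupp a b hab
      exact ⟨hDB ha, hDB hb, hadj⟩
  · have key := twoState_filler hT Finset.disjoint_sdiff τ
      (fun a ha => ⟨(hτ a ha).1, (hτ a ha).2.1, (hτ a ha).2.2.1⟩)
      (W' := fun a b => if a ∈ B \ D ∧ b = τ a then 1 else W a b) ?_ ?_ ?_ ?_
    · rwa [Finset.union_sdiff_of_subset hDB] at key
    · intro a ha b _
      rw [if_neg]
      rintro ⟨h, -⟩
      exact (Finset.mem_sdiff.1 h).2 ha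
    · intro a ha b hb
      rw [if_neg]
      · by_contra hne
        exact (Finset.mem_sdiff.1 hb).2 (hsupp a b hne).2.1
      · rintro ⟨h, -⟩
        exact (Finset.mem_sdiff.1 h).2 ha
    · intro a ha b _ _ hbτ
      rw [if_neg fun h => hbτ h.2]
      by_contra hne
      exact (Finset.mem_sdiff.1 ha).2 (hsupp a b hne).1
    · intro a ha
      rw [if_pos ⟨ha, rfl⟩]

/-- **Fillers in the grid, second form.**  As `gad_fill`, with the hypotheses in the form the
parallel layout provides them: non-zero darts stay inside `B` and join adjacent cells, and no
non-zero dart starts or ends in the filler region `B ∖ D`. [folklore] -/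
theorem gad_fill' {W : ℕ × ℕ → ℕ × ℕ → MvPolynomial ι R} {D B : Finset (ℕ × ℕ)} {p q : ℕ × ℕ}
    {g : MvPolynomial ι R} (τ : ℕ × ℕ → ℕ × ℕ) (hlab : ∀ a b, IsLab⟦W a b⟧)
    (hsupp : ∀ a b, W a b ≠ 0 → a ∈ B ∧ b ∈ B ∧ Adj⟦a, b⟧)
    (hzero : ∀ a b, a ∈ B \ D ∨ b ∈ B \ D → W a b = 0) (hT : TwoState⟦D, W, p, q, g⟧)
    (hDB : D ⊆ B) (hτ : ∀ a ∈ B \ D, τ a ∈ B \ D ∧ τ a ≠ a ∧ τ (τ a) = a ∧ Adj⟦a, τ a⟧) :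
    ∃ W' : ℕ × ℕ → ℕ × ℕ → MvPolynomial ι R, (∀ a b, IsLab⟦W' a b⟧) ∧
      (∀ a b, W' a b ≠ 0 → a ∈ B ∧ b ∈ B ∧ Adj⟦a, b⟧) ∧ TwoState⟦B, W', p, q, g⟧ := by
  refine ⟨fun a b => if a ∈ B \ D ∧ b = τ a then 1 else W a b, fun a b => isLab_ite isLab_one (hlab a b),
    ?_, ?_⟩
  · intro a b hab
    by_cases h : a ∈ B \ D ∧ b = τ a
    · obtain ⟨ha, rfl⟩ := h
      exact ⟨(Finset.mem_sdiff.1 ha).1, (Finset.mem_sdiff.1 (hτ a ha).1).1, (hτ a ha).2.2.2⟩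
    · dsimp only at hab
      rw [if_neg h] at hab
      exact hsupp a b hab
  · have key := twoState_filler hT Finset.disjoint_sdiff τ
      (fun a ha => ⟨(hτ a ha).1, (hτ a ha).2.1, (hτ a ha).2.2.1⟩)
      (W' := fun a b => if a ∈ B \ D ∧ b = τ a then 1 else W a b) ?_ ?_ ?_ ?_
    · rwa [Finset.union_sdiff_of_subset hDB] at key
    · intro a ha b _
      rw [if_neg]
      rintro ⟨h, -⟩
      exact (Finset.mem_sdiff.1 h).2 ha
    · intro a ha b hb
      rw [if_neg, hzero a b (Or.inr hb)]
      rintro ⟨h, -⟩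
      exact (Finset.mem_sdiff.1 h).2 ha
    · intro a ha b _ _ hbτ
      rw [if_neg fun h => hbτ h.2, hzero a b (Or.inl ha)]
    · intro a ha
      rw [if_pos ⟨ha, rfl⟩]

/-- **The row gadget** (leaves and unit pads): on the `h × (2k+2)` rectangle at `(r, c)`, the top row
is a path whose first edge carries the label `ℓ` (the other dart of that edge and all other path
edges are unit) and the rows below are tiled by horizontal unit dominoes; it is a grid gadget for
`ℓ` (`twoState_path` + `gad_fill`). [folklore] -/
theorem gad_row {ℓ : MvPolynomial ι R} (hℓ : IsLab⟦ℓ⟧) (r c h k : ℕ) (hh : 1 ≤ h) :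
    ∃ W : ℕ × ℕ → ℕ × ℕ → MvPolynomial ι R, Gad⟦W, r, c, h, 2 * k + 2, ℓ⟧ := by
  -- the path on the top row
  let Wp : ℕ × ℕ → ℕ × ℕ → MvPolynomial ι R := fun u v =>
    if u.1 = r ∧ v.1 = r ∧ c ≤ u.2 ∧ c ≤ v.2 ∧ u.2 < c + (2 * k + 2) ∧ v.2 < c + (2 * k + 2) ∧
        (u.2 + 1 = v.2 ∨ v.2 + 1 = u.2) then (if u.2 = c ∧ v.2 = c + 1 then ℓ else 1) else 0
  have hWp : ∀ u v, Wp u v = if u.1 = r ∧ v.1 = r ∧ c ≤ u.2 ∧ c ≤ v.2 ∧ u.2 < c + (2 * k + 2) ∧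
      v.2 < c + (2 * k + 2) ∧ (u.2 + 1 = v.2 ∨ v.2 + 1 = u.2) then
        (if u.2 = c ∧ v.2 = c + 1 then ℓ else 1) else 0 := fun u v => rfl
  have hpath := twoState_path (W := Wp) (fun i => (r, c + i)) (ℓ := ℓ) k
    (fun i _ j _ h => by simpa using h)
    (by
      rw [hWp, hWp, if_pos (by dsimp only; omega), if_pos (by dsimp only; omega),
        if_pos (by dsimp only; omega), if_neg (by dsimp only; omega), mul_one])
    (fun i h1 h2 => by
      rw [hWp, hWp, if_pos (by dsimp only; omega), if_neg (by dsimp only; omega),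
        if_pos (by dsimp only; omega), if_neg (by dsimp only; omega), mul_one])
    (fun i hi j hj hne => by
      by_contra hc
      apply hne
      rw [hWp, if_neg (by dsimp only; omega)])
  have himg : (Finset.range (2 * k + 2)).image (fun i => (r, c + i)) = box⟦r, c, 1, 2 * k + 2⟧ := by
    ext v
    simp only [Finset.mem_image, Finset.mem_range, mem_box]
    constructor
    · rintro ⟨i, hi, rfl⟩
      simp only
      omega
    · intro hv
      exact ⟨v.2 - c, by omega, Prod.ext (by simp; omega) (by simp; omega)⟩
  rw [himg] at hpath
  have hsupp : ∀ a b, Wp a b ≠ 0 → a ∈ box⟦r, c, 1, 2 * k + 2⟧ ∧ b ∈ box⟦r, c, 1, 2 * k + 2⟧ ∧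
      Adj⟦a, b⟧ := by
    intro a b hab
    rw [hWp] at hab
    by_cases hcond : a.1 = r ∧ b.1 = r ∧ c ≤ a.2 ∧ c ≤ b.2 ∧ a.2 < c + (2 * k + 2) ∧
        b.2 < c + (2 * k + 2) ∧ (a.2 + 1 = b.2 ∨ b.2 + 1 = a.2)
    · rw [mem_box, mem_box]
      omega
    · exact absurd (if_neg hcond) hab
  have hτ : ∀ a ∈ box⟦r, c, h, 2 * k + 2⟧ \ box⟦r, c, 1, 2 * k + 2⟧,
      (fun v : ℕ × ℕ => (v.1, if (v.2 + c) % 2 = 0 then v.2 + 1 else v.2 - 1)) a ∈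
          box⟦r, c, h, 2 * k + 2⟧ \ box⟦r, c, 1, 2 * k + 2⟧ ∧
        (fun v : ℕ × ℕ => (v.1, if (v.2 + c) % 2 = 0 then v.2 + 1 else v.2 - 1)) a ≠ a ∧
        (fun v : ℕ × ℕ => (v.1, if (v.2 + c) % 2 = 0 then v.2 + 1 else v.2 - 1))
          ((fun v : ℕ × ℕ => (v.1, if (v.2 + c) % 2 = 0 then v.2 + 1 else v.2 - 1)) a) = a ∧
        Adj⟦a, (fun v : ℕ × ℕ => (v.1, if (v.2 + c) % 2 = 0 then v.2 + 1 else v.2 - 1)) a⟧ := by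
    intro a ha
    simp only [Finset.mem_sdiff, mem_box] at ha
    refine ⟨?_, ?_, ?_, ?_⟩
    · simp only [Finset.mem_sdiff, mem_box]
      split_ifs <;> omega
    · intro h
      have := congrArg Prod.snd h
      simp only at this
      split_ifs at this <;> omega
    · ext
      · rfl
      · simp only
        split_ifs <;> omega
    · dsimp only
      split_ifs <;> omega
  obtain ⟨W', hlab', hsupp', hT'⟩ := gad_fill (B := box⟦r, c, h, 2 * k + 2⟧)
    (fun v => (v.1, if (v.2 + c) % 2 = 0 then v.2 + 1 else v.2 - 1))
    (fun a b => by rw [hWp]; exact isLab_ite (isLab_ite hℓ isLab_one) isLab_zero) hsupp hpath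
    (fun v hv => by rw [mem_box] at hv ⊢; omega) hτ
  refine ⟨W', hlab', hsupp', ?_⟩
  simpa only [Nat.add_zero, show c + (2 * k + 2) - 1 = c + (2 * k + 1) by omega] using hT'

end Grid

end FormulaGridProjection

open Finset FormulaGridProjection in
/-- **Registered sub-goal `stub_formulaGridProjection_rowGadget`** of `stub_formulaGridProjection`
(crux stmt-ValiantsHypothesis-5066, line `planar-dimer-sign-elimination`): the ROW GADGET — for a
label `ℓ` and any `h ≥ 1` there is a labelled sub-adjacency of the `h × (2k+2)` grid rectangle at
`(r, c)` which is a two-state gadget for `ℓ` with ports the two top corners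
(`FormulaGridProjection.gad_row` with the notation expanded). [folklore] -/
theorem stub_formulaGridProjection_rowGadget : ∀ (R : Type) [CommSemiring R] (ι : Type) (ℓ : MvPolynomial ι R) (r c h k : ℕ), ((∃ j, ℓ = MvPolynomial.X j) ∨ ∃ c, ℓ = MvPolynomial.C c) → 1 ≤ h → ∃ W : ℕ × ℕ → ℕ × ℕ → MvPolynomial ι R, ((∀ a b, ((∃ j, W a b = MvPolynomial.X j) ∨ ∃ c, W a b = MvPolynomial.C c)) ∧ (∀ a b, W a b ≠ 0 → a ∈ (Finset.Ico r (r + h) ×ˢ Finset.Ico c (c + (2 * k + 2)) : Finset (ℕ × ℕ)) ∧ b ∈ (Finset.Ico r (r + h) ×ˢ Finset.Ico c (c + (2 * k + 2)) : Finset (ℕ × ℕ)) ∧ ((Prod.fst a + 1 = Prod.fst b ∧ Prod.snd a = Prod.snd b) ∨ (Prod.fst b + 1 = Prod.fst a ∧ Prod.snd a = Prod.snd b) ∨ (Prod.fst a = Prod.fst b ∧ Prod.snd a + 1 = Prod.snd b) ∨ (Prod.fst a = Prod.fst b ∧ Prod.snd b + 1 = Prod.snd a))) ∧ ((r, c) ∈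 (Finset.Ico r (r + h) ×ˢ Finset.Ico c (c + (2 * k + 2)) : Finset (ℕ × ℕ)) ∧ (r, c + (2 * k + 2) - 1) ∈ (Finset.Ico r (r + h) ×ˢ Finset.Ico c (c + (2 * k + 2)) : Finset (ℕ × ℕ)) ∧ (r, c) ≠ (r, c + (2 * k + 2) - 1) ∧ Even (Finset.card (Finset.Ico r (r + h) ×ˢ Finset.Ico c (c + (2 * k + 2)) : Finset (ℕ × ℕ))) ∧ Summit.ValiantsHypothesis.ValiantsHypothesis.Theorems.DivisionGapZeroOneTransfer.FormulaGridProjection.msum (Finset.Ico r (r + h) ×ˢ Finset.Ico c (c + (2 * k + 2)) : Finset (ℕ × ℕ)) W = ℓ ∧ Summit.ValiantsHypothesis.ValiantsHypothesis.Theorems.DivisionGapZeroOneTransfer.FormulaGridProjection.msum (Finset.erase (Finset.erase (Finset.Ico r (r + h) ×ˢ Finset.Ico c (c + (2 * k + 2)) : Finset (ℕ × ℕ)) (r, c)) (r, c + (2 * k + 2) - 1)) W = 1)) :=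
  fun _ _ _ _ r c h k hℓ hh => gad_row hℓ r c h k hh

end Summit.ValiantsHypothesis.ValiantsHypothesis.Theorems.DivisionGapZeroOneTransfer
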